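/-
Origin: expansion seat `planner-pub-hodgecm-carver-0`, handover 2026-08-18T03:30:15Z (`HOME/pub-hodgecm-carver/lean/Carver/PerL34/CharsCore.lean`, md5 975a680f, 31 lines);
landed by the gen-5 packager in gate run 18 as `HodgeCM/PerL34/CharsCore.lean` (import ^import Carver\.PerL34\.→import HodgeCM.PerL34. ×1).
-/
/-
Origin: HOME/pub-hodgecm-carver/lean/Carver/PerL34/CharsCore.lean — session planner-pub-hodgecm-carver-0 (unit
pub-hodgecm-carver, THE CARVER).  Intended final place: `HodgeCM/PerL34/CharsCore.lean`.
PROOF of the typed core of DAG node N30 (PerL v5 Lemma 4.2(a), Kronecker step, tex l. 539) from Mathlib.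
-/
import Summits.HodgeConjecture.HodgeCM.PerL34.Chars

set_option autoImplicit false

/-!
# N30 core (Kronecker's theorem) — proved

PerL v5 Lemma 4.2(a), proof, tex ll. 537–539: "its intersection with `\U(1)(L_0\otimes\R)\times K'` …
consists of elements of `\mathcal O_L^\times` all of whose conjugates have absolute value `1`, i.e.\ of roots of
unity (Kronecker)".  PRINT: L. Kronecker, *Zwei Sätze über Gleichungen mit ganzzahligen Coefficienten*,
J. reine angew. Math. 53 (1857), 173–175, Satz I; in Mathlib as
`NumberField.Embeddings.pow_eq_one_of_norm_eq_one` (with `A := ℂ`).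
-/

namespace HodgeCM
namespace PerL34

/-- **N30 core holds** (Kronecker): an algebraic integer of a number field all of whose complex conjugates
have absolute value `1` is a root of unity. -/
theorem N30_core_kronecker_holds : N30_core_kronecker := by
  intro K _ _ x hxi hx
  obtain ⟨n, hn, h⟩ := NumberField.Embeddings.pow_eq_one_of_norm_eq_one K ℂ hxi hx
  exact ⟨n, hn, h⟩

end PerL34
end HodgeCM
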